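import Summits.KontsevichZagierPeriods.KontsevichZagierPeriods.Theorems.SoloBlindCauchyChartB
import Literature.Analysis.SpecialFunctions.SelbergIntegralBasic
import Mathlib.MeasureTheory.Function.JacobianOneDim
import HarnessLib

/-!
# The edge integrand of the Cauchy argument: `-P_p(x, 0)` on `(-∞,0) ∪ (0,½)`

Sorry-free.  The second Stokes route for the admissible `2`-dimensional representation
`[D, h_p]` (file `SoloBlindCauchyIntegrable`) integrates in `y` first and leaves the edge
integral `∫_{x<½} -P_p(x,0) dx` on the real axis, where (file `SoloBlindCauchyForm`)

* `-P_p(x,0) = -(x(1-x))^{e} = -x^{e}(1-x)^{e}` for `0 < x < ½`, and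
* `-P_p(x,0) = -cos(πe) (-(x(1-x)))^{e}` for `x < 0`, `e = p/5 - 1`.

This file supplies the one-variable facts about this edge integrand `edgeF p`:

* the base `baseA = {x < ½, x ≠ 0}` and the semialgebraicity of `x ↦ edgeF p (x 0)` on it
  (as the composite of the semialgebraic `P_p` with `x ↦ (x, 0)`);
* the substitution `x = -m(v) = -v/(1-v)`, `v ∈ (0,1)`, which carries `(-∞, 0)` onto `(0,1)`
  and turns `(-(x(1-x)))^{e} dx` into the **Beta integrand** `v^{e}(1-v)^{-2e-2} dv`
  (`jacobi_negMoeb`), whence integrability of `edgeF p` on `baseA` for `p ∈ {1, 2}` from the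
  integrability of the Beta integrands `B(p/5, p/5)` and `B(p/5, 1 - 2p/5)`
  [`Literature.Analysis.SpecialFunctions.Selberg.integrableOn_Ioo_rpow_mul_one_sub_rpow_and_integral_eq`].
-/

noncomputable section

open Set MeasureTheory Complex
open scoped ContDiff
open Literature.ModelTheory.ExponentialFields MvPolynomial
open Literature.NumberTheory.Transcendental
open Literature.NumberTheory.Transcendental.KZ
open Literature.Analysis.SpecialFunctions.Selberg

namespace Summit.KontsevichZagierPeriods.KontsevichZagierPeriods.Theorems

namespace SoloBlind

/-! ## The base `(-∞,0) ∪ (0,½)` -/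

/-- The base of the edge integral: `{x < ½, x ≠ 0}`. -/
def baseA : Set ℝ := {x | x < 1 / 2 ∧ x ≠ 0}

/-- `line baseA` is semialgebraic over `ℚ`. -/
theorem isSemialgebraic_line_baseA : IsSemialgebraic ℚ (line baseA) := by
  refine (congrArg (IsSemialgebraic (R := ℝ) ℚ) ?_).mpr
    ((isSemialgebraic_setOf_eval_pos (k := ℚ) (R := ℝ)
      (1 - 2 * X 0 : MvPolynomial (Fin 1) ℚ)).inter
      (isSemialgebraic_setOf_eval_ne_zero (k := ℚ) (R := ℝ) (X 0 : MvPolynomial (Fin 1) ℚ)))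
  ext x
  simp only [line, baseA, mem_setOf_eq, mem_inter_iff, map_sub, map_mul, map_one,
    MvPolynomial.aeval_X]
  constructor
  · rintro ⟨h1, h2⟩; exact ⟨by norm_num at h1 ⊢; linarith, h2⟩
  · rintro ⟨h1, h2⟩; exact ⟨by norm_num at h1 ⊢; linarith, h2⟩

/-- `baseA = (-∞, 0) ∪ (0, ½)`. -/
theorem baseA_eq : baseA = Iio 0 ∪ Ioo 0 (1 / 2) := by
  ext x
  simp only [baseA, mem_setOf_eq, mem_union, mem_Iio, mem_Ioo]
  constructor
  · rintro ⟨h1, h2⟩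
    rcases lt_or_gt_of_ne h2 with h | h
    · exact Or.inl h
    · exact Or.inr ⟨h, h1⟩
  · rintro (h | ⟨h1, h2⟩)
    · exact ⟨by linarith, h.ne⟩
    · exact ⟨h2, h1.ne'⟩

/-! ## The edge integrand -/

/-- The edge integrand `edgeF p x = -P_p(x, 0)`. -/
def edgeF (p : ℕ) (x : ℝ) : ℝ := -Pz p ![x, 0]

/-- On `(0,1)`: `edgeF p x = -x^{e}(1-x)^{e}`, `e = p/5 - 1`. -/
theorem edgeF_eq_of_pos (p : ℕ) {x : ℝ} (hx0 : 0 < x) (hx1 : x < 1) :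
    edgeF p x = -(x ^ ((p : ℝ) / 5 - 1) * (1 - x) ^ ((p : ℝ) / 5 - 1)) := by
  rw [edgeF, (Pz_apply p x 0).1, ofReal_zero, zero_mul, add_zero, re_gPow_ofReal_pos hx0 hx1,
    Real.mul_rpow hx0.le (by linarith)]

/-- On `(-∞,0)`: `edgeF p x = -cos(πe) (-(x(1-x)))^{e}`. -/
theorem edgeF_eq_of_neg (p : ℕ) {x : ℝ} (hx : x < 0) :
    edgeF p x = -(Real.cos (Real.pi * ((p : ℝ) / 5 - 1)) *
      (-(x * (1 - x))) ^ ((p : ℝ) / 5 - 1)) := by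
  rw [edgeF, (Pz_apply p x 0).1, ofReal_zero, zero_mul, add_zero, re_gPow_ofReal_neg hx]

/-- `x ↦ edgeF p (x 0)` is semialgebraic on `line baseA`. -/
theorem sa_edgeF (p : ℕ) : IsSemialgebraicFunOn ℚ (line baseA) (fun x => edgeF p (x 0)) := by
  have hmap : IsSemialgebraicMapOn ℚ (line baseA)
      (fun x : Fin 1 → ℝ => (![x 0, 0] : Fin 2 → ℝ)) := by
    refine IsSemialgebraicMapOn.of_forall isSemialgebraic_line_baseA fun j => ?_
    fin_cases j
    · exact (isSemialgebraicFunOn_aeval isSemialgebraic_line_baseA (X 0)).congr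
        fun x _ => by simp
    · exact (isSemialgebraicFunOn_aeval isSemialgebraic_line_baseA
        (0 : MvPolynomial (Fin 1) ℚ)).congr fun x _ => by simp
  have hto : MapsTo (fun x : Fin 1 → ℝ => (![x 0, 0] : Fin 2 → ℝ)) (line baseA) Eup := by
    intro x hx
    have hx' : x 0 < 1 / 2 ∧ x 0 ≠ 0 := hx
    refine ⟨?_, ?_, Or.inr ?_⟩
    · simp
    · simpa using hx'.1.le
    · simpa using hx'.2
  exact ((sa_PQ p).1.comp_isSemialgebraicMapOn_holds hmap hto).fun_neg.congr fun _ _ => rfl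

/-! ## The substitution `x = -m(v)` -/

/-- `v ↦ -m(v)` maps `(0,1)` onto `(-∞,0)`. -/
theorem image_negMoeb : (fun v => -moeb v) '' Ioo 0 1 = Iio 0 := by
  ext y
  constructor
  · rintro ⟨v, hv, rfl⟩
    exact neg_neg_of_pos (moeb_pos hv.1 hv.2)
  · intro hy
    have hy' : 0 < -y := neg_pos.mpr hy
    refine ⟨-y / (1 + -y), ⟨div_pos hy' (by linarith), (div_lt_one (by linarith)).mpr
      (by linarith)⟩, ?_⟩
    simp only
    rw [moeb_div_one_add hy'.le, neg_neg]

/-- `v ↦ -m(v)` is injective on `(0,1)`. -/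
theorem injOn_negMoeb : InjOn (fun v => -moeb v) (Ioo (0 : ℝ) 1) :=
  fun _ hs _ ht h => injOn_moeb (mem_Iio.mpr hs.2) (mem_Iio.mpr ht.2) (neg_injective h)

/-- **The Jacobian identity** of the substitution `x = -m(v)`:
`(-(x(1-x)))^{e} · m'(v) = v^{e} (1-v)^{-2e-2}` for `v ∈ (0,1)`. -/
theorem jacobi_negMoeb (e : ℝ) {v : ℝ} (hv : v ∈ Ioo (0 : ℝ) 1) :
    (-((-moeb v) * (1 - -moeb v))) ^ e * (1 / (1 - v) ^ 2) = v ^ e * (1 - v) ^ (-2 * e - 2) := by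
  have h1 : 0 < 1 - v := by linarith [hv.2]
  have hin : -((-moeb v) * (1 - -moeb v)) = v / (1 - v) ^ 2 := by
    rw [moeb]
    field_simp
    ring
  have hsq : ((1 - v) ^ 2 : ℝ) = (1 - v) ^ (2 : ℝ) := by
    rw [← Real.rpow_natCast]
    norm_num
  rw [hin, Real.div_rpow hv.1.le (sq_nonneg _), hsq, ← Real.rpow_mul h1.le, one_div,
    ← Real.rpow_neg h1.le, div_eq_mul_inv, ← Real.rpow_neg h1.le, mul_assoc,
    ← Real.rpow_add h1]
  congr 1
  congr 1
  ring

/-- `(-(x(1-x)))^{e}` is integrable on `(-∞, 0)` for `-1 < e < -1/2`: under `x = -m(v)` it is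
the Beta integrand of `B(e+1, -2e-1)`. -/
theorem integrableOn_negSide {e : ℝ} (he1 : -1 < e) (he2 : e < -1 / 2) :
    IntegrableOn (fun x : ℝ => (-(x * (1 - x))) ^ e) (Iio 0) := by
  have hder : ∀ v ∈ Ioo (0 : ℝ) 1,
      HasDerivWithinAt (fun v => -moeb v) (-(1 / (1 - v) ^ 2)) (Ioo 0 1) v :=
    fun v hv => (hasDerivAt_moeb (ne_of_lt hv.2)).neg.hasDerivWithinAt
  rw [← image_negMoeb,
    integrableOn_image_iff_integrableOn_abs_deriv_smul measurableSet_Ioo hder injOn_negMoeb]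
  have hβ := (integrableOn_Ioo_rpow_mul_one_sub_rpow_and_integral_eq (a := e + 1)
    (b := -2 * e - 1) (by linarith) (by linarith)).1
  refine hβ.congr_fun (fun v hv => ?_) measurableSet_Ioo
  have h1 : 0 < 1 - v := by linarith [hv.2]
  rw [show e + 1 - 1 = e by ring, show (-2 : ℝ) * e - 1 - 1 = -2 * e - 2 by ring, smul_eq_mul,
    abs_neg, abs_of_pos (by positivity : (0 : ℝ) < 1 / (1 - v) ^ 2),
    mul_comm (1 / (1 - v) ^ 2), jacobi_negMoeb e hv]

/-- **Integrability of the edge integrand** on `baseA` for `p ∈ {1, 2}`. -/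
theorem integrableOn_edgeF (p : ℕ) (hp : p = 1 ∨ p = 2) : IntegrableOn (edgeF p) baseA := by
  have he1 : (-1 : ℝ) < (p : ℝ) / 5 - 1 := by rcases hp with rfl | rfl <;> norm_num
  have he2 : (p : ℝ) / 5 - 1 < -1 / 2 := by rcases hp with rfl | rfl <;> norm_num
  have ha : (0 : ℝ) < (p : ℝ) / 5 := by linarith
  rw [baseA_eq]
  refine IntegrableOn.union ?_ ?_
  · have h : IntegrableOn (fun x : ℝ => -(Real.cos (Real.pi * ((p : ℝ) / 5 - 1)) *
        (-(x * (1 - x))) ^ ((p : ℝ) / 5 - 1))) (Iio 0) :=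
      ((integrableOn_negSide he1 he2).const_mul _).neg
    exact h.congr_fun (fun x hx => (edgeF_eq_of_neg p hx).symm) measurableSet_Iio
  · have hβ := (integrableOn_Ioo_rpow_mul_one_sub_rpow_and_integral_eq ha ha).1
    have h : IntegrableOn (fun x : ℝ => -(x ^ ((p : ℝ) / 5 - 1) * (1 - x) ^ ((p : ℝ) / 5 - 1)))
        (Ioo 0 (1 / 2)) := (hβ.mono_set (Ioo_subset_Ioo_right (by norm_num))).neg
    exact h.congr_fun (fun x hx => (edgeF_eq_of_pos p hx.1 (by linarith [hx.2])).symm)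
      measurableSet_Ioo

/-- **The edge representation** `[baseA, -P_p(·, 0)]`, an admissible `1`-dimensional
representation for `p ∈ {1, 2}`. -/
def edgeRepA (p : ℕ) (hp : p = 1 ∨ p = 2) : IntegralRep 1 :=
  lineRep baseA (edgeF p) isSemialgebraic_line_baseA (sa_edgeF p) (integrableOn_edgeF p hp)

end SoloBlind

end Summit.KontsevichZagierPeriods.KontsevichZagierPeriods.Theorems
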